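import Summits.Ventures.DiscreteObjects.STD.NoOrderSeven

/-!
# STD₂[12;6]: under an automorphism of order 3 moving every point class, all fixed blocks lie in one block class (kernel)
Framing: lottery ticket; floor = certified bounds/negative ranges.

Cell pub-namedobj (target M), STD₂[12;6] automorphism census, order-3 landscape (designs g6, FAMILY-P5.md §8 (ii)). In the
incidence-array vocabulary of `OrderFiveReduction`: let `τ` be an array automorphism with `σ³ = 1`. A point of a MOVED point class
lies on at most one `τ`-fixed block (`fixed_blocks_separate_on_moved_class`: two fixed blocks through `(i,a)` contain the whole
orbit `(σᵐ i, aₘ)`, `m < 3`, hence meet in ≥ 3 > 2 points or coincide); consequently, if `σ` moves EVERY point class, any two fixed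
blocks belong to the same block class (`fixed_blocks_one_class`) — the structural half of the cells (4,4), (4,3), (4,2) of
FAMILY-P5 §8 (the other half, '#fixed blocks = #fixed block classes', is the trace identity and is not formalised here).
-/

namespace Summit.Ventures.DiscreteObjects.STD

open Finset Equiv Summit.Ventures.DiscreteObjects.PP12

section OrderThree

variable (π : IncArray 12 6) (τ : ArrayAut π)

/-- The orbit of a point on a fixed block stays on it: if `ρ j = j`, `β j c = c` and `π i j a = c`, then with
`a₀ = a`, `aₘ₊₁ = α (σᵐ i) aₘ` one has `π (σᵐ i) j aₘ = c` for all `m`. -/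
theorem orbit_on_fixed_block {j : Fin 12} {c : Fin 6} (hj : τ.ρ j = j) (hc : τ.β j c = c) {i : Fin 12} {a : Fin 6}
    (h : π i j a = c) (m : ℕ) :
    π ((τ.σ ^ m) i) j (Nat.rec a (fun m b => τ.α ((τ.σ ^ m) i) b) m) = c := by
  induction m with
  | zero => simpa using h
  | succ m ih =>
    simp only
    rw [pow_succ', Perm.mul_apply]
    have hm := τ.map_inc ((τ.σ ^ m) i) j (Nat.rec a (fun m b => τ.α ((τ.σ ^ m) i) b) m)
    rw [hj, ih, hc] at hm
    exact hm

/-- **Two fixed blocks never share a point of a moved class** (order 3). If `σ³ = 1`, `σ i ≠ i`, and the point `(i,a)` lies on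
the `τ`-fixed blocks `(j₁,c₁)` and `(j₂,c₂)`, then they are the same block. -/
theorem fixed_blocks_separate_on_moved_class (hπ : IsSTD 2 π) (hσ : τ.σ ^ 3 = 1) {i : Fin 12} (hi : τ.σ i ≠ i)
    {a : Fin 6} {j₁ j₂ : Fin 12} {c₁ c₂ : Fin 6} (hj₁ : τ.ρ j₁ = j₁) (hc₁ : τ.β j₁ c₁ = c₁) (hj₂ : τ.ρ j₂ = j₂)
    (hc₂ : τ.β j₂ c₂ = c₂) (h₁ : π i j₁ a = c₁) (h₂ : π i j₂ a = c₂) : j₁ = j₂ ∧ c₁ = c₂ := by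
  by_cases hj : j₁ = j₂
  · subst hj
    exact ⟨rfl, h₁.symm.trans h₂⟩
  · exfalso
    have hcount := hπ.2 j₁ j₂ hj c₁ c₂
    have hsub : (univ.image fun m : Fin 3 => (τ.σ ^ (m : ℕ)) i) ⊆
        univ.filter (fun i' => (π i' j₁).symm c₁ = (π i' j₂).symm c₂) := by
      intro i' hi'
      obtain ⟨m, -, rfl⟩ := mem_image.mp hi'
      simp only [mem_filter, mem_univ, true_and]
      have e₁ := orbit_on_fixed_block π τ hj₁ hc₁ h₁ m
      have e₂ := orbit_on_fixed_block π τ hj₂ hc₂ h₂ m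
      rw [← e₁, ← e₂, Equiv.symm_apply_apply, Equiv.symm_apply_apply]
    have hcard : (univ.image fun m : Fin 3 => (τ.σ ^ (m : ℕ)) i).card = 3 := by
      rw [card_image_of_injective _ (pow_apply_injective_prime Nat.prime_three hσ hi)]; simp
    have := card_le_card hsub
    rw [hcard, hcount] at this
    omega

/-- **All fixed blocks in one class.** If `σ³ = 1` and `σ` moves every point class, two `τ`-fixed blocks belong to the same
block class (two fixed blocks of different classes would meet in exactly 2 points, but their intersection is a union of
3-orbits). -/
theorem fixed_blocks_one_class (hπ : IsSTD 2 π) (hσ : τ.σ ^ 3 = 1) (hall : ∀ i, τ.σ i ≠ i)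
    {j₁ j₂ : Fin 12} {c₁ c₂ : Fin 6} (hj₁ : τ.ρ j₁ = j₁) (hc₁ : τ.β j₁ c₁ = c₁) (hj₂ : τ.ρ j₂ = j₂)
    (hc₂ : τ.β j₂ c₂ = c₂) : j₁ = j₂ := by
  by_contra hj
  -- the two blocks meet in exactly 2 points; take one of them
  have hcount := hπ.2 j₁ j₂ hj c₁ c₂
  obtain ⟨i, hi⟩ : ∃ i, i ∈ univ.filter (fun i' => (π i' j₁).symm c₁ = (π i' j₂).symm c₂) := by
    apply Finset.Nonempty.exists_mem
    rw [← card_pos, hcount]; norm_num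
  simp only [mem_filter, mem_univ, true_and] at hi
  have h₁ : π i j₁ ((π i j₁).symm c₁) = c₁ := Equiv.apply_symm_apply _ _
  have h₂ : π i j₂ ((π i j₁).symm c₁) = c₂ := by rw [hi]; exact Equiv.apply_symm_apply _ _
  exact hj (fixed_blocks_separate_on_moved_class π τ hπ hσ (hall i) hj₁ hc₁ hj₂ hc₂ h₁ h₂).1

end OrderThree

end Summit.Ventures.DiscreteObjects.STD
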